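import Literature.Probability.Percolation.IntFramesReroute
import Literature.Probability.Percolation.TrapMultiExits
import Literature.Probability.Percolation.IntPairBuildR
import HarnessLib

/-!
# The inner `k`-exit datum: Nolin's arm separation, internal extremities, any number of arms (surgery)

Topic: Probability / Percolation; family `crit-perc` (site percolation on the triangular lattice
`𝕋 = triGraph`). The INNER twin of `TrapMultiExits.lean`: the combinatorial ("surgery") half of
the step for INTERNAL extremities of Nolin's arm-separation theorem, for an ARBITRARY pattern
`κ : Fin k → Bool` (Nolin 2008, Thm. 11, §4.4 [arXiv 0711.4948: Thm. 10, p. 13]: "the internal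
extremities are treated in the same way, using the regions `U^{int}`"), towards
`Literature.Probability.Percolation.Nolin2008_prop17_quasiMult` (`FiveArmExponentFacts.lean`).
The tree had it for two arms of one colour (`int_colour_exits`, `IntPairBuildR.lean`,
multiplicity `≤ 2` by the cut-counting/Menger pair step); here any number of arms of each colour
is handled by the generic rerouting in the half-annuli `intDom m` (`IntFramesReroute.lean`,
after Kesten–Sidoravicius–Zhang 1998, App. §7) and the inner fence attachment / no-invasion
theorems (`IntFenceAttach.lean`).

Given `k` pairwise disjoint actual arms `W q` of colours `κ q` with sites of norm in `[m, N']`,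
far ends `x q` beyond `Λ_{2m}` and inner ends `y q` on `∂Λ_m`, and the good events of the six
inner frames for both colours (`IntFrameGood`, `IntPairBuildR.lean`: both explorations short and
rawly good, corner guards), `int_multi_exits` produces the inner `k`-EXIT DATUM in the format of
`int_colour_exits`: for every arm a frame `i q < 6`, an inner exit
`F q : IntExit m (intAnnRegion m N') k₀ K (rotConfig (i q) (colCfg (κ q) ω))` (far end the reading of
`x q`, nominal tip `32 k_j`-middle at every scale, an open vertical crossing of the corner box
inside `Λ_m` through the fence site) protected from below (`IntTipProt`), an open route `S q` from
the far end to the fence site inside the annulus-or-exit-zone, tight inside `Λ_m`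
(`IntExitTight`), whose sites beyond `Λ_{2m}` are read from the arm `W q` itself (far provenance:
the outer landing of the arm is untouched); disjoint actual structures for equal colours; on a
common side distinct tips, `17k` apart for equal colours, not within `8k` above for different
colours.

## Main results

* `IntFrameTransversals.iter_norm_le`, `IntFrameTransversals.iter_mem_of_gt` — norms stay
  `≤ N'`; sites of norm `> 2m` of the members are sites of the original arm.
* `IntFrameTransversals.exit_route`, `IntFrameTransversals.same_colour_pair`,
  `int_tip_row_gap_of_compl` — inner twins of the bricks of `TrapMultiExits.lean`.
* `int_multi_exits` — the inner `k`-exit datum (`5 ≤ m`, `4m ≤ N'`, `2 ≤ k₀`, `1 ≤ K`,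
  `64 k_j < m`, guards `32 k_{K-1} + 1 ≤ Rᵢ`, `4Rᵢ < m`).

## References

* P. Nolin, *Near-critical percolation in two dimensions*, Electron. J. Probab. 13 (2008), §4.4,
  Thm. 11 and Lemma 15 (proofs), internal extremities [arXiv 0711.4948: Thm. 10, Lemma 14,
  p. 13]. [Nolin2008]
* H. Kesten, V. Sidoravicius, Y. Zhang, *Almost all words are seen in critical site percolation
  on the triangular lattice*, Electron. J. Probab. 3 (1998), paper 10, App. §7 (7.9)–(7.10),
  p. 27. [KestenSidoraviciusZhang1998]
* H. Kesten, *Scaling relations for 2D-percolation*, Comm. Math. Phys. 109 (1987), Lemmas 2, 4.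
  [Kesten1987]

Tree: `IntFrameTransversals` (`IntFramesReroute.lean`), `IntTermFence`,
`IntRawOK.nonempty_intTermFence`, `intFenceSet_box`, `mem_intFenceSet_inside/beyond`
(`IntTermFence.lean`), `JDomain.Transversal.int_termFence_q_mem_reroute`,
`int_not_mem_of_mem_termFence`, `intTermFence_disjoint_of_lt` (`IntFenceAttach.lean`),
`IntFrameGood`, `IntExit`, `intExitZone`, `intAnnRegion`, `IntExitTight`,
`intExitTight_of_mem_intFenceSet`, `IntTipProt`, `tip_bounds_of_guards`, `intMidTip_of_guards`,
`rot_intTipBox_ne`, `exists_intRawOK_of_not_failRaw`, `IntRawOK.no_escape`,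
`start_far_from_ends`, `colCfg_not`, `rotConfig_compl'` (`TrapMultiExits.lean`).
-/

noncomputable section

namespace Literature.Probability.Percolation

open LatticeModels HalfAnnulus

open JDomain

/-! ### Two more invariants of the inner protocol -/

namespace IntFrameTransversals

variable {m : ℕ} {χ : SiteConfig (Site 2)} {𝒯 : IntFrameTransversals m χ}

/-- A site of an inner step is a site of the member or a site of the half-annulus read back
(norm `≤ 2m`). [folklore] -/
theorem mem_or_le_of_mem_step {i : ℕ} {E : Set (Site 2)} {a v : Site 2} (hv : v ∈ 𝒯.step i E a) :
    v ∈ E ∨ triNorm v ≤ 2 * m := by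
  obtain ⟨w, hw, rfl⟩ := hv
  cases h : (𝒯.τ i).firstTerm (frameRd i E) ((triRotIsoPow i).symm a) with
  | none =>
    rw [Transversal.mem_reroute_iff_of_none h] at hw
    exact Or.inl (mem_frameRd.1 (Transversal.comp_subset hw))
  | some u =>
    obtain ⟨⟨⟨c, z⟩, hu⟩, -, -⟩ := Transversal.firstTerm_spec h
    rcases Transversal.reroute_subset_union h hu hw with hw | hw
    · exact Or.inl (mem_frameRd.1 hw)
    · right
      rw [triNorm_rot]
      have hwD := (isCrossing_of_lowestSeq hu).1.subset (Finset.mem_coe.1 hw)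
      rw [intDom_D] at hwD
      exact (mem_haFin.1 hwD).2.2

/-- **Upper norm bound along the inner protocol** (`2m ≤ N'`). [folklore] -/
theorem iter_norm_le {E : Set (Site 2)} {a : Site 2} {N' : ℤ} (hmN : 2 * (m : ℤ) ≤ N') (hE : ∀ v ∈ E, triNorm v ≤ N') :
    ∀ f, ∀ v ∈ 𝒯.iter f E a, triNorm v ≤ N'
  | 0 => hE
  | f + 1 => fun v hv => by
    rcases mem_or_le_of_mem_step hv with h | h
    · exact iter_norm_le hmN hE f v h
    · exact h.trans hmN

/-- **Far provenance**: the sites of norm `> 2m` of the members are sites of the original member. [folklore] -/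
theorem iter_mem_of_gt {E : Set (Site 2)} {a : Site 2} : ∀ f, ∀ v ∈ 𝒯.iter f E a, 2 * (m : ℤ) < triNorm v → v ∈ E
  | 0 => fun _ hv _ => hv
  | f + 1 => fun v hv hvn => by
    rcases mem_or_le_of_mem_step hv with h | h
    · exact iter_mem_of_gt f v h hvn
    · omega

end IntFrameTransversals

/-! ### The route of one inner exit -/

namespace IntFrameTransversals

variable {m : ℕ} {χ : SiteConfig (Site 2)} (𝒯 : IntFrameTransversals m χ)

/-- **The route of an inner exit**: the reading of the final member in its last frame together
with the connection of the inner fence of its last term is a `𝕋`-connected open route from the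
reading of the far end to the fence site inside `Λ_m`, inside the annulus-or-exit-zone, tight
inside `Λ_m`, whose sites of norm `> 2m` are read from the original member. [cite: Nolin2008, §4.4 Lemma 15 and Thm. 11 (proof), internal extremities (arXiv 0711.4948: Lemma 14, Thm. 10)] -/
theorem exit_route (hm : 5 ≤ m) {E : Set (Site 2)} {s : Site 2} {N' : ℕ} (hOK : MemberOK m χ E s) (hs : 2 * (m : ℤ) < triNorm s)
    (hmN : 2 * m ≤ N') (hEN : ∀ v ∈ E, triNorm v ≤ N')
    {f u : ℕ} {c : Finset (Site 2)} {z : Site 2} {k : ℕ} (hft : 𝒯.termAt f E s = some u) (hf : f = 𝒯.lastFrame E s)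
    (hu : (intDom m).lowestSeq (rotConfig f χ) u = some (c, z)) (hraw : IntRawOK m c z k (rotConfig f χ))
    (hk : 2 ≤ k) (hkm : 64 * k < m) (hz8 : -(m : ℤ) + 8 * k < z 1 ∧ z 1 + 8 * k < 0)
    (Tf : IntTermFence m c z k (rotConfig f χ) ↑c) :
    PathIn triGraph (frameRd f (𝒯.final E s) ∪ Tf.F) ((triRotIsoPow f).symm s) Tf.m' ∧
      frameRd f (𝒯.final E s) ∪ Tf.F ⊆ (intAnnRegion m N' ∪ intExitZone m z k) ∩ rotConfig f χ ∧
      (∀ v ∈ frameRd f (𝒯.final E s) ∪ Tf.F, triNorm v < m → IntExitTight z k v) ∧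
      (∀ v ∈ frameRd f (𝒯.final E s) ∪ Tf.F, 2 * (m : ℤ) < triNorm v → triRotIsoPow f v ∈ E) := by
  subst hf
  have hfin := memberOK_final (𝒯 := 𝒯) hm hOK hs
  have hRd := frameRd_final (𝒯 := 𝒯) hm hOK hs
  have hk1 : 1 ≤ k := by omega
  have hq : Tf.q ∈ frameRd (𝒯.lastFrame E s) (𝒯.final E s) := by
    rw [hRd]
    exact Transversal.int_termFence_q_mem_reroute _ hm hu hraw hk1 hkm hz8 Tf hft
  have hconn : ∀ x ∈ frameRd (𝒯.lastFrame E s) (𝒯.final E s),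
      PathIn triGraph (frameRd (𝒯.lastFrame E s) (𝒯.final E s)) ((triRotIsoPow (𝒯.lastFrame E s)).symm s) x := by
    intro x hx
    have := pathIn_frameRd (i := 𝒯.lastFrame E s) (hfin.conn _ (mem_frameRd.1 hx))
    rwa [RelIso.symm_apply_apply] at this
  have hRdn : ∀ v ∈ frameRd (𝒯.lastFrame E s) (𝒯.final E s), (m : ℤ) ≤ triNorm v ∧ triNorm v ≤ N' := by
    intro v hv
    have hv' := mem_frameRd.1 hv
    refine ⟨?_, ?_⟩
    · have := hfin.norm_ge _ hv'
      rwa [triNorm_rot] at this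
    · have := iter_norm_le (𝒯 := 𝒯) (a := s) (by exact_mod_cast hmN) hEN 6 _ hv'
      rwa [triNorm_rot] at this
  have hsub : frameRd (𝒯.lastFrame E s) (𝒯.final E s) ∪ Tf.F ⊆
      (intAnnRegion m N' ∪ intExitZone m z k) ∩ rotConfig (𝒯.lastFrame E s) χ := by
    rintro v (hv | hv)
    · exact ⟨Or.inl (mem_intAnnRegion.2 (hRdn v hv)), frameRd_subset_rotConfig hfin.subset hv⟩
    · have hv' := Tf.F_subset hv
      exact ⟨Or.inr (intFrameZone_subset_intExitZone hv'.1.1.1), intFenceSet_subset hv'⟩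
  refine ⟨?_, hsub, ?_, ?_⟩
  · have P1 := (hconn _ hq).mono (Set.subset_union_left (t := Tf.F))
    have P2 : PathIn triGraph (frameRd (𝒯.lastFrame E s) (𝒯.final E s) ∪ Tf.F) Tf.q Tf.p :=
      PathIn.of_adj (Set.mem_union_left _ hq) (Set.mem_union_right _ Tf.path.left_mem) Tf.adj
    exact P1.trans (P2.trans (Tf.path.mono Set.subset_union_right))
  · rintro v (hv | hv) hvn
    · exact absurd (hRdn v hv).1 (not_le.2 hvn)
    · exact intExitTight_of_mem_intFenceSet hk (Tf.F_subset hv) hvn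
  · rintro v (hv | hv) hvn
    · exact iter_mem_of_gt (𝒯 := 𝒯) 6 _ (mem_frameRd.1 hv) (by rwa [triNorm_rot])
    · exfalso
      have hv' := (Tf.F_subset hv).1.1.1
      rw [mem_intFrameZone] at hv'
      rcases hv'.1 with h | h
      · have := (mem_haSet.1 h).2.2; omega
      · have := (mem_hinSet.1 h.1).2; omega

/-! ### Sites of an inner structure lie in the tip box -/

/-- Fence sites and corner-strip sites lie in the square of half-width `2k + 1` about the tip. [folklore] -/
theorem box_of_mem_fence_or_strip {c : Finset (Site 2)} {z : Site 2} {k : ℕ} {ω : SiteConfig (Site 2)}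
    (Tf : IntTermFence m c z k ω ↑c) {v : Site 2} (hv : v ∈ Tf.F ∨ v ∈ triStrip (z 0 - 2 * k) (z 1 + k) k k) :
    z 0 - (2 * k + 1) ≤ v 0 ∧ v 0 ≤ z 0 + (2 * k + 1) ∧ z 1 - (2 * k + 1) ≤ v 1 ∧ v 1 ≤ z 1 + (2 * k + 1) := by
  rcases hv with hv | hv
  · exact intFenceSet_box (Tf.F_subset hv)
  · rw [mem_triStrip] at hv
    omega

/-- Inner corner-strip sites are inside `Λ_m` (`8k`-middle tip, `1 ≤ k`). [folklore] -/
theorem triNorm_lt_of_mem_strip {z : Site 2} {k : ℕ} (hz : IsIntJ m z) (hz8 : -(m : ℤ) + 8 * k < z 1 ∧ z 1 + 8 * k < 0)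
    (hk : 1 ≤ k) {v : Site 2} (hv : v ∈ triStrip (z 0 - 2 * k) (z 1 + k) k k) : triNorm v < m := by
  rw [mem_triStrip] at hv
  obtain ⟨hz0, hz1, hz2⟩ := hz
  have hk' : (1 : ℤ) ≤ k := by exact_mod_cast hk
  rw [triNorm_eq_max]
  simp only [max_lt_iff]
  omega

/-! ### Two inner exits of the same colour -/

/-- **The structures of two inner exits of the same colour are disjoint, and on a common side
their tips are distinct and `17k` apart** (inner twin of `FrameTransversals.same_colour_pair`,
with `rot_intTipBox_ne` for different sides). [cite: Nolin2008, §4.4 Lemma 15 and Thm. 11 (proof), internal extremities (arXiv 0711.4948: Lemma 14, Thm. 10)] -/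
theorem same_colour_pair (hm : 5 ≤ m) {E E' : Set (Site 2)} {s s' : Site 2} (hOK : MemberOK m χ E s)
    (hOK' : MemberOK m χ E' s') (hsM : 2 * (m : ℤ) < triNorm s) (hs'M : 2 * (m : ℤ) < triNorm s') (hdisj : Disjoint E E')
    {f u : ℕ} {c : Finset (Site 2)} {z : Site 2} {k : ℕ} (hft : 𝒯.termAt f E s = some u) (hf : f = 𝒯.lastFrame E s)
    (hu : (intDom m).lowestSeq (rotConfig f χ) u = some (c, z)) (hraw : IntRawOK m c z k (rotConfig f χ))
    (hk : 1 ≤ k) (hkm : 64 * k < m) (hz8 : -(m : ℤ) + 8 * k < z 1 ∧ z 1 + 8 * k < 0)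
    (Tf : IntTermFence m c z k (rotConfig f χ) ↑c)
    {f' u' : ℕ} {c' : Finset (Site 2)} {z' : Site 2} {k' : ℕ} (hft' : 𝒯.termAt f' E' s' = some u')
    (hf' : f' = 𝒯.lastFrame E' s') (hu' : (intDom m).lowestSeq (rotConfig f' χ) u' = some (c', z'))
    (hraw' : IntRawOK m c' z' k' (rotConfig f' χ)) (hk' : 1 ≤ k') (hk'm : 64 * k' < m)
    (hz8' : -(m : ℤ) + 8 * k' < z' 1 ∧ z' 1 + 8 * k' < 0) (Tf' : IntTermFence m c' z' k' (rotConfig f' χ) ↑c')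
    (hf6 : f < 6) (hf'6 : f' < 6)
    (hbox : f ≠ f' → ∃ κ : ℕ, k ≤ κ ∧ k' ≤ κ ∧
      (-(m : ℤ) + 8 * κ ≤ z 1 ∧ z 1 ≤ -(8 * (κ : ℤ))) ∧ (-(m : ℤ) + 8 * κ ≤ z' 1 ∧ z' 1 ≤ -(8 * (κ : ℤ)))) :
    Disjoint (triRotIsoPow f '' (frameRd f (𝒯.final E s) ∪ Tf.F ∪ triStrip (z 0 - 2 * k) (z 1 + k) k k))
        (triRotIsoPow f' '' (frameRd f' (𝒯.final E' s') ∪ Tf'.F ∪ triStrip (z' 0 - 2 * k') (z' 1 + k') k' k')) ∧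
      (f = f' → z 1 ≠ z' 1) ∧ (f = f' → z 1 < z' 1 → z 1 + 17 * k < z' 1) := by
  have hcut := intDom_cutProp hm
  have hc := (isCrossing_of_lowestSeq hu).1
  have hc' := (isCrossing_of_lowestSeq hu').1
  have hz := tip_isIntJ hc
  have hz' := tip_isIntJ hc'
  have hfin := memberOK_final (𝒯 := 𝒯) hm hOK hsM
  have hfin' := memberOK_final (𝒯 := 𝒯) hm hOK' hs'M
  have hdfin : Disjoint (𝒯.final E s) (𝒯.final E' s') := disjoint_final hm hOK hOK' hsM hs'M hdisj
  -- no invasion, both ways (each in the frame of the fence)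
  have hinv' : ∀ x ∈ Tf'.F, x ∉ frameRd f' (𝒯.final E s) := by
    subst hf'
    obtain ⟨h1, h2, h3, h4, h5⟩ := frameRd_final_other (𝒯 := 𝒯) hm hOK' hOK hs'M hsM hdisj.symm
    intro x hx
    exact Transversal.int_not_mem_of_mem_termFence _ hm hu' hraw' hk' hk'm hz8' Tf' hft' h1 h2 h3 h4 h5 hx
  have hinv : ∀ x ∈ Tf.F, x ∉ frameRd f (𝒯.final E' s') := by
    subst hf
    obtain ⟨h1, h2, h3, h4, h5⟩ := frameRd_final_other (𝒯 := 𝒯) hm hOK hOK' hsM hs'M hdisj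
    intro x hx
    exact Transversal.int_not_mem_of_mem_termFence _ hm hu hraw hk hkm hz8 Tf hft h1 h2 h3 h4 h5 hx
  -- norms
  have hRn : ∀ v ∈ frameRd f (𝒯.final E s), (m : ℤ) ≤ triNorm v := fun v hv => by
    have := hfin.norm_ge _ (mem_frameRd.1 hv); rwa [triNorm_rot] at this
  have hR'n : ∀ v ∈ frameRd f' (𝒯.final E' s'), (m : ℤ) ≤ triNorm v := fun v hv => by
    have := hfin'.norm_ge _ (mem_frameRd.1 hv); rwa [triNorm_rot] at this
  -- same frame: distinct terms, ordered tips
  have hsame : f = f' → u ≠ u' ∧ (z 1 < z' 1 → u < u') ∧ (z' 1 < z 1 → u' < u) ∧ z 1 ≠ z' 1 := by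
    intro hff
    subst hff
    have hne : u ≠ u' := termAt_ne_of_disjoint hm hOK hOK' hsM hs'M hdisj hft hft'
    have h1 : u < u' → z 1 < z' 1 := fun h => ht_lowestSeq_lt_of_lt hcut h hu hu'
    have h2 : u' < u → z' 1 < z 1 := fun h => ht_lowestSeq_lt_of_lt hcut h hu' hu
    refine ⟨hne, fun h => ?_, fun h => ?_, ?_⟩
    · rcases Nat.lt_or_gt_of_ne hne with h' | h'
      · exact h'
      · have := h2 h'; omega
    · rcases Nat.lt_or_gt_of_ne hne with h' | h'
      · have := h1 h'; omega
      · exact h'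
    · rcases Nat.lt_or_gt_of_ne hne with h' | h'
      · exact (h1 h').ne
      · exact (h2 h').ne'
  refine ⟨?_, fun hff => (hsame hff).2.2.2, fun hff hlt => ?_⟩
  · refine Set.disjoint_left.2 ?_
    rintro X ⟨x₁, hx₁, rfl⟩ ⟨x₂, hx₂, hX⟩
    by_cases hff : f = f'
    · subst hff
      have hx : x₂ = x₁ := (triRotIsoPow f).injective hX
      subst hx
      obtain ⟨hne, hlt, hgt, hzz⟩ := hsame rfl
      have hFF : Disjoint Tf.F Tf'.F ∧ (u < u' → z 1 + 17 * k < z' 1) ∧ (u' < u → z' 1 + 17 * k' < z 1) := by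
        rcases Nat.lt_or_gt_of_ne hne with h | h
        · have := intTermFence_disjoint_of_lt hm h hu hu' hraw hk hkm hz8 Tf Tf'
          exact ⟨this.1, fun _ => this.2, fun h' => absurd h (Nat.lt_asymm h')⟩
        · have := intTermFence_disjoint_of_lt hm h hu' hu hraw' hk' hk'm hz8' Tf' Tf
          exact ⟨this.1.symm, fun h' => absurd h (Nat.lt_asymm h'), fun _ => this.2⟩
      obtain ⟨hFdisj, hgap, hgap'⟩ := hFF
      have hk1 : (1 : ℤ) ≤ k := by exact_mod_cast hk
      have hk1' : (1 : ℤ) ≤ k' := by exact_mod_cast hk'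
      rcases hx₁ with (h₁ | h₁) | h₁ <;> rcases hx₂ with (h₂ | h₂) | h₂
      · exact Set.disjoint_left.1 hdfin (mem_frameRd.1 h₁) (mem_frameRd.1 h₂)
      · exact hinv' _ h₂ h₁
      · exact absurd (hRn _ h₁) (not_le.2 (triNorm_lt_of_mem_strip hz' hz8' hk' h₂))
      · exact hinv _ h₁ h₂
      · exact Set.disjoint_left.1 hFdisj h₁ h₂
      · -- fence of `c` against the strip of `c'`
        have hb₁ := intFenceSet_box (Tf.F_subset h₁)
        have hins := triNorm_lt_of_mem_strip hz' hz8' hk' h₂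
        have hrow := mem_intFenceSet_beyond (Tf.F_subset h₁) hins
        rw [mem_triStrip] at h₂
        rcases Nat.lt_or_gt_of_ne hne with h | h
        · have := hgap h; omega
        · have := hgap' h; omega
      · exact absurd (hR'n _ h₂) (not_le.2 (triNorm_lt_of_mem_strip hz hz8 hk h₁))
      · have hb₂ := intFenceSet_box (Tf'.F_subset h₂)
        have hins := triNorm_lt_of_mem_strip hz hz8 hk h₁
        have hrow := mem_intFenceSet_beyond (Tf'.F_subset h₂) hins
        rw [mem_triStrip] at h₁
        rcases Nat.lt_or_gt_of_ne hne with h | h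
        · have := hgap h; omega
        · have := hgap' h; omega
      · rw [mem_triStrip] at h₁ h₂
        rcases Nat.lt_or_gt_of_ne hne with h | h
        · have := hgap h; omega
        · have := hgap' h; omega
    · -- different frames
      obtain ⟨κ, hkκ, hk'κ, hzκ, hz'κ⟩ := hbox hff
      have hκ1 : 1 ≤ κ := hk.trans hkκ
      have hkκ' : (k : ℤ) ≤ κ := by exact_mod_cast hkκ
      have hk'κ' : (k' : ℤ) ≤ κ := by exact_mod_cast hk'κ
      obtain ⟨hz0, -, -⟩ := hz
      obtain ⟨hz'0, -, -⟩ := hz'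
      have hboxes : ∀ {v w : Site 2}, (v ∈ Tf.F ∨ v ∈ triStrip (z 0 - 2 * k) (z 1 + k) k k) →
          (w ∈ Tf'.F ∨ w ∈ triStrip (z' 0 - 2 * k') (z' 1 + k') k' k') → triRotIsoPow f v ≠ triRotIsoPow f' w := by
        intro v w hv hw heq
        have bv := box_of_mem_fence_or_strip Tf hv
        have bw := box_of_mem_fence_or_strip Tf' hw
        exact rot_intTipBox_ne hκ1 hzκ hz'κ ⟨by omega, by omega, by omega, by omega⟩
          ⟨by omega, by omega, by omega, by omega⟩ hf6 hf'6 hff heq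
      have hzJ := tip_isIntJ hc
      have hz'J := tip_isIntJ hc'
      rcases hx₁ with (h₁ | h₁) | h₁ <;> rcases hx₂ with (h₂ | h₂) | h₂
      · have hX₁ := mem_frameRd.1 h₁
        have hX₂ := mem_frameRd.1 h₂
        rw [hX] at hX₂
        exact Set.disjoint_left.1 hdfin hX₁ hX₂
      · have : x₂ ∈ frameRd f' (𝒯.final E s) := mem_frameRd.2 (by rw [hX]; exact mem_frameRd.1 h₁)
        exact hinv' _ h₂ this
      · have hn₁ := hRn _ h₁
        have hn₂ := triNorm_lt_of_mem_strip hz'J hz8' hk' h₂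
        rw [← triNorm_rot f x₁, ← hX, triNorm_rot] at hn₁
        exact absurd hn₁ (not_le.2 hn₂)
      · have : x₁ ∈ frameRd f (𝒯.final E' s') := mem_frameRd.2 (by rw [← hX]; exact mem_frameRd.1 h₂)
        exact hinv _ h₁ this
      · exact hboxes (Or.inl h₁) (Or.inl h₂) hX.symm
      · exact hboxes (Or.inl h₁) (Or.inr h₂) hX.symm
      · have hn₂ := hR'n _ h₂
        have hn₁ := triNorm_lt_of_mem_strip hzJ hz8 hk h₁
        rw [← triNorm_rot f' x₂, hX, triNorm_rot] at hn₂
        exact absurd hn₂ (not_le.2 hn₁)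
      · exact hboxes (Or.inr h₁) (Or.inl h₂) hX.symm
      · exact hboxes (Or.inr h₁) (Or.inr h₂) hX.symm
  · obtain ⟨hne, hlt', -, -⟩ := hsame hff
    subst hff
    exact (intTermFence_disjoint_of_lt hm (hlt' hlt) hu hu' hraw hk hkm hz8 Tf Tf').2

end IntFrameTransversals

/-! ### Two inner exits of different colours on a common side -/

/-- **Inner tips of terms of complementary colours on one side are distinct, and a tip of the
other colour is not within `8k` rows above a raw-good tip** (`32k < m`; inner twin of
`tip_row_gap_of_compl`, by `IntRawOK.no_escape`). [cite: Nolin2008, §4.4 Lemma 15 and Thm. 11 (proof), internal extremities (arXiv 0711.4948: Lemma 14, Thm. 10)] -/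
theorem int_tip_row_gap_of_compl {m k : ℕ} {ω : SiteConfig (Site 2)} {c c' : Finset (Site 2)} {z z' : Site 2}
    (hc : (intDom m).IsCrossing c z) (hcω : (↑c : Set (Site 2)) ⊆ ω) (hraw : IntRawOK m c z k ω) (hk : 1 ≤ k)
    (hkm : 32 * k < m) (hc' : (intDom m).IsCrossing c' z') (hc'ω : (↑c' : Set (Site 2)) ⊆ ωᶜ) :
    z 1 ≠ z' 1 ∧ (z 1 < z' 1 → z 1 + 8 * k < z' 1) := by
  obtain ⟨hz0, hz1, hz2⟩ := tip_isIntJ hc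
  obtain ⟨hz'0, hz'1, hz'2⟩ := tip_isIntJ hc'
  refine ⟨fun hrow => ?_, fun hlt => ?_⟩
  · have hzz : z = z' := by
      ext i; fin_cases i
      · exact hz0.trans hz'0.symm
      · exact hrow
    exact hc'ω (Finset.mem_coe.2 (hzz ▸ hc'.tip_mem)) (hcω (Finset.mem_coe.2 hc.tip_mem))
  · by_contra h8
    push Not at h8
    obtain ⟨t, htc', htF⟩ := hc'.exists_start
    have hk' : (1 : ℤ) ≤ k := by exact_mod_cast hk
    have hq : z' ∈ (intDom m).Tp ∪ (intDom m).Jabove z := by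
      refine Finset.mem_union_right _ (mem_Jabove.2 ⟨hc'.tip_mem_J, ?_⟩)
      simpa using hlt
    have hfar := start_far_from_ends (R := 8 * k) (by omega) htF (z 1) ⟨by omega, by omega⟩
    refine hraw.no_escape hk hc hcω (q := z') (t := t) hq ⟨by omega, by omega, by omega, by omega⟩
      (by push_cast at hfar ⊢; omega) ?_
    exact (hc'.conn _ hc'.tip_mem _ htc').mono fun v hv =>
      ⟨by rw [← coe_haFin, ← intDom_D]; exact Finset.mem_coe.2 (hc'.subset (Finset.mem_coe.1 hv)), hc'ω hv⟩


/-! ### The inner `k`-exit datum -/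

/-- A site of norm `m` read on side `0` of its frame lies in `[-m, 0]` in rows. [folklore] -/
theorem row_bounds_of_apply_zero_eq {m : ℕ} {w : Site 2} (hw0 : w 0 = m) (hwn : triNorm w = m) : -(m : ℤ) ≤ w 1 ∧ w 1 ≤ 0 := by
  have h := hwn.le
  rw [triNorm_eq_max] at h
  simp only [max_le_iff] at h
  omega

set_option maxHeartbeats 800000 in
/-- **Nolin's arm separation, internal extremities, surgery step, any number of arms.** Given
`k` disjoint actual arms `W q` (colour `κ q`, sites of norm in `[m, N']`, far ends `x q` beyond
`Λ_{2m}`, inner ends `y q` on `∂Λ_m`) and the good events of the six inner frames for both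
colours (`IntFrameGood`: short rawly-good explorations and the two corner guards), there are, for
every arm, a frame `i q < 6`, an inner exit `F q` of the colour read in that frame
(`IntExit m (intAnnRegion m N') k₀ K`, far end the reading of `x q`, middle nominal tip at every
scale, fence from below) protected from below (`IntTipProt`), and an open route `S q` from the
far end to the fence site inside the annulus-or-exit-zone, tight inside `Λ_m`, whose sites
beyond `Λ_{2m}` are read from the arm itself; the actual structures (route and corner strip) of
two arms of the same colour are disjoint; tips on a common side are distinct, `17k` apart for
equal colours and not within `8k` above for different colours. The arms are rerouted colour by
colour over the six inner frames (`IntFramesReroute.lean`) and the inner fence of the last term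
of each final member is attached to it (`IntFenceAttach.lean`). [cite: Nolin2008, §4.4 Thm. 11 (proof), internal extremities (arXiv 0711.4948: Thm. 10, p. 13)] -/
theorem int_multi_exits {k m N' k₀ K T T' R₁ R₂ : ℕ} (κ : Fin k → Bool) (hm : 5 ≤ m) (hN : 4 * m ≤ N') (hk₀ : 2 ≤ k₀)
    (hK : 1 ≤ K) (hKm : ∀ j < K, 64 * trapScale k₀ j < m)
    (hR₁ : 32 * trapScale k₀ (K - 1) + 1 ≤ R₁) (hR₂ : 32 * trapScale k₀ (K - 1) + 1 ≤ R₂) (h4R₁ : 4 * R₁ < m) (h4R₂ : 4 * R₂ < m)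
    {ω : SiteConfig (Site 2)} {x y : Fin k → Site 2} (W : (q : Fin k) → triGraph.Walk (x q) (y q))
    (hfar : ∀ q, 2 * (m : ℤ) < triNorm (x q)) (hsupp : ∀ q, ∀ v ∈ (W q).support, (m : ℤ) ≤ triNorm v ∧ triNorm v ≤ N')
    (hcol : ∀ q, ∀ v ∈ (W q).support, v ∈ colCfg (κ q) ω) (hyn : ∀ q, triNorm (y q) = m)
    (hdisj : ∀ q q', q ≠ q' → ∀ v ∈ (W q).support, v ∉ (W q').support)
    (hgood : ∀ f < 6, ∀ b : Bool, IntFrameGood m k₀ K T T' R₁ R₂ (rotConfig f (colCfg b ω))) :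
    ∃ (i : Fin k → ℕ) (F : (q : Fin k) → IntExit m (intAnnRegion m N') k₀ K (rotConfig (i q) (colCfg (κ q) ω)))
      (S : Fin k → Set (Site 2)),
      (∀ q, i q < 6) ∧ (∀ q, (F q).b = (triRotIsoPow (i q)).symm (x q)) ∧
      (∀ q, ∀ j < K, -(m : ℤ) + 32 * trapScale k₀ j + 1 ≤ (F q).z 1 ∧ (F q).z 1 ≤ -(32 * (trapScale k₀ j : ℤ) + 1)) ∧
      (∀ q, IntTipProt m false ((F q).z 1) (trapScale k₀ (F q).j) (rotConfig (i q) (colCfg (κ q) ω))) ∧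
      (∀ q, PathIn triGraph (S q) (F q).b (F q).m') ∧
      (∀ q, S q ⊆ (intAnnRegion m N' ∪ intExitZone m (F q).z (trapScale k₀ (F q).j)) ∩ rotConfig (i q) (colCfg (κ q) ω)) ∧
      (∀ q, ∀ v ∈ S q, triNorm v < m → IntExitTight (F q).z (trapScale k₀ (F q).j) v) ∧
      (∀ q, ∀ v ∈ S q, 2 * (m : ℤ) < triNorm v → triRotIsoPow (i q) v ∈ (W q).support) ∧
      (∀ a b, a ≠ b → κ a = κ b →
        Disjoint (triRotIsoPow (i a) '' (S a ∪ triStrip ((F a).z 0 - 2 * trapScale k₀ (F a).j) ((F a).z 1 + trapScale k₀ (F a).j)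
            (trapScale k₀ (F a).j) (trapScale k₀ (F a).j)))
          (triRotIsoPow (i b) '' (S b ∪ triStrip ((F b).z 0 - 2 * trapScale k₀ (F b).j) ((F b).z 1 + trapScale k₀ (F b).j)
            (trapScale k₀ (F b).j) (trapScale k₀ (F b).j)))) ∧
      (∀ a b, a ≠ b → i a = i b → (F a).z 1 ≠ (F b).z 1) ∧
      (∀ a b, κ a = κ b → i a = i b → (F a).z 1 < (F b).z 1 → (F a).z 1 + 17 * trapScale k₀ (F a).j < (F b).z 1) ∧
      (∀ a b, κ a ≠ κ b → i a = i b → (F a).z 1 < (F b).z 1 → (F a).z 1 + 8 * trapScale k₀ (F a).j < (F b).z 1) := by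
  classical
  -- members: the sets of sites of the arms
  set E : Fin k → Set (Site 2) := fun q => {v | v ∈ (W q).support} with hEdef
  have hOK : ∀ q, IntFrameTransversals.MemberOK m (colCfg (κ q) ω) (E q) (x q) := fun q =>
    ⟨fun v hv => hcol q v hv, fun v hv => (hsupp q v hv).1, (W q).start_mem_support,
      fun v hv => (PathIn.of_walk_mem_support (W q) (A := {v | v ∈ (W q).support}) (fun _ h => h) hv).1⟩
  have hEN : ∀ q, ∀ v ∈ E q, triNorm v ≤ N' := fun q v hv => (hsupp q v hv).2
  have hEdisj : ∀ a b, a ≠ b → Disjoint (E a) (E b) := fun a b hab =>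
    Set.disjoint_left.2 fun v hva hvb => hdisj a b hab v hva hvb
  -- the transversals, colour by colour
  let 𝒯 : (b : Bool) → IntFrameTransversals m (colCfg b ω) := fun b => Classical.choice (nonempty_intFrameTransversals hm _)
  -- the inner ends are read on the tip arc of the frame of their side (corner guards)
  have hyJ : ∀ q, ∃ i < 6, (triRotIsoPow i).symm (y q) ∈ (intDom m).J := by
    intro q
    obtain ⟨i, hi6, hi0⟩ := exists_rot_symm_apply_zero_eq (y q)
    rw [hyn q] at hi0
    have hwn : triNorm ((triRotIsoPow i).symm (y q)) = m := by rw [triNorm_rot_symm, hyn q]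
    obtain ⟨hw1, hw2⟩ := row_bounds_of_apply_zero_eq hi0 hwn
    obtain ⟨-, -, -, -, hg₁, hg₂⟩ := hgood i hi6 (κ q)
    -- the arm read in frame `i`, from its inner end to its far end
    have hP : PathIn triGraph (frameRd i (E q) ∩ rotConfig i (colCfg (κ q) ω)) ((triRotIsoPow i).symm (y q))
        ((triRotIsoPow i).symm (x q)) := by
      have h1 : PathIn triGraph (E q) (y q) (x q) :=
        (PathIn.of_walk_mem_support (W q) (A := {v | v ∈ (W q).support}) (fun _ h => h) (W q).end_mem_support).1.symm
      exact (pathIn_frameRd (i := i) h1).mono fun v hv => ⟨hv, frameRd_subset_rotConfig (hOK q).subset hv⟩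
    have hb : 2 * (m : ℤ) ≤ triNorm ((triRotIsoPow i).symm (x q)) := by rw [triNorm_rot_symm]; exact (hfar q).le
    have hts : 1 ≤ trapScale k₀ (K - 1) := one_le_trapScale (by omega) _
    have hbd := tip_bounds_of_guards (m := m) (by omega) h4R₁ (by omega) h4R₂ hg₁ hg₂ hi0 hwn hb hP
    refine ⟨i, hi6, mem_intDom_J.2 ⟨mem_haFin.2 ⟨by omega, hwn.ge, by omega⟩, hi0, by omega, by omega⟩⟩
  -- last frames and terms
  obtain ⟨f, hfdef⟩ : ∃ f : Fin k → ℕ, ∀ q, f q = (𝒯 (κ q)).lastFrame (E q) (x q) := ⟨_, fun q => rfl⟩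
  have hf6 : ∀ q, f q < 6 := fun q => by rw [hfdef]; exact IntFrameTransversals.lastFrame_lt_six _ _
  have hterm : ∀ q, ∃ u, (𝒯 (κ q)).termAt (f q) (E q) (x q) = some u := fun q => by
    rw [hfdef]
    exact Option.ne_none_iff_exists'.1 (IntFrameTransversals.termAt_lastFrame_ne_none hm (hOK q) (hfar q)
      (W q).end_mem_support (hyJ q))
  choose u hu using hterm
  have hcz : ∀ q, ∃ cz : Finset (Site 2) × Site 2,
      (intDom m).lowestSeq (rotConfig (f q) (colCfg (κ q) ω)) (u q) = some cz := fun q => by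
    obtain ⟨c, z, h⟩ := IntFrameTransversals.exists_lowestSeq_of_term (hu q)
    exact ⟨(c, z), h⟩
  choose cz hcz using hcz
  -- the good events
  have hFG : ∀ q, IntFrameGood m k₀ K T T' R₁ R₂ (rotConfig (f q) (colCfg (κ q) ω)) := fun q => hgood (f q) (hf6 q) (κ q)
  have huT : ∀ q, u q < T := fun q => by
    by_contra h
    push Not at h
    have := JDomain.lowestSeq_eq_none_of_le (hFG q).1 h
    rw [hcz q] at this
    exact absurd this (by simp)
  have hraw' : ∀ q, ∃ j < K, IntRawOK m (cz q).1 (cz q).2 (trapScale k₀ j) (rotConfig (f q) (colCfg (κ q) ω)) :=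
    fun q => exists_intRawOK_of_not_failRaw ((hFG q).2.1 (u q) (huT q)) (hcz q)
  choose j hjK hraw using hraw'
  have hcr : ∀ q, (intDom m).IsCrossing (cz q).1 (cz q).2 ∧
      (↑(cz q).1 : Set (Site 2)) ⊆ rotConfig (f q) (colCfg (κ q) ω) := fun q => JDomain.isCrossing_of_lowestSeq (hcz q)
  have hk1 : ∀ q, 1 ≤ trapScale k₀ (j q) := fun q => one_le_trapScale (by omega) _
  have hk2 : ∀ q, 2 ≤ trapScale k₀ (j q) := fun q => hk₀.trans (le_trapScale _ _)
  have hkm : ∀ q, 64 * trapScale k₀ (j q) < m := fun q => hKm (j q) (hjK q)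
  -- middle tips, from the guards
  have hmid : ∀ q, ∀ j' < K, -(m : ℤ) + 32 * trapScale k₀ j' + 1 ≤ (cz q).2 1 ∧ (cz q).2 1 ≤ -(32 * (trapScale k₀ j' : ℤ) + 1) := by
    intro q j' hj'
    obtain ⟨-, -, -, -, hg₁, hg₂⟩ := hFG q
    have hle : trapScale k₀ j' ≤ trapScale k₀ (K - 1) := trapScale_mono k₀ (by omega)
    have h := intMidTip_of_guards (m := m) (R₀ := 32 * trapScale k₀ j' + 1) (by omega) h4R₁ (by omega) h4R₂ (by omega)
      (hcr q).1 (hcr q).2 hg₁ hg₂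
    unfold IntMidTip at h
    push_cast at h
    constructor <;> omega
  have hz8 : ∀ q, -(m : ℤ) + 8 * trapScale k₀ (j q) < (cz q).2 1 ∧ (cz q).2 1 + 8 * trapScale k₀ (j q) < 0 := fun q => by
    have := hmid q (j q) (hjK q); constructor <;> omega
  -- the fences, by components
  have hTf : ∀ q, ∃ (mm qq pp : Site 2) (Fs : Set (Site 2)),
      OpenVCrossThrough (triStrip ((cz q).2 0 - 2 * trapScale k₀ (j q)) ((cz q).2 1 + trapScale k₀ (j q))
        (trapScale k₀ (j q)) (trapScale k₀ (j q))) ((cz q).2 1 + trapScale k₀ (j q))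
        ((cz q).2 1 + 2 * trapScale k₀ (j q)) (rotConfig (f q) (colCfg (κ q) ω)) mm ∧
      qq ∈ (↑(cz q).1 : Set (Site 2)) ∧ triGraph.Adj qq pp ∧
      Fs ⊆ intFenceSet m (cz q).1 (cz q).2 (trapScale k₀ (j q)) (rotConfig (f q) (colCfg (κ q) ω)) ↑(cz q).1 ∧
      PathIn triGraph Fs pp mm ∧ (∀ x ∈ Fs, PathIn triGraph Fs pp x) := fun q => by
    have htk : -(m : ℤ) + 2 * trapScale k₀ (j q) + 1 ≤ (cz q).2 1 ∧ (cz q).2 1 ≤ -(2 * (trapScale k₀ (j q) : ℤ) + 1) := by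
      have := hz8 q; have h1 : (1 : ℤ) ≤ trapScale k₀ (j q) := by exact_mod_cast hk1 q
      constructor <;> omega
    obtain ⟨Tf⟩ := (hraw q).nonempty_intTermFence hm (hk1 q) (hcr q).1 htk subset_rfl fun v hv => by
      have hvD := (hcr q).1.subset (Finset.mem_coe.1 hv)
      rw [intDom_D] at hvD
      exact (mem_haFin.1 hvD).2.1
    exact ⟨Tf.m', Tf.q, Tf.p, Tf.F, Tf.vcross, Tf.q_mem, Tf.adj, Tf.F_subset, Tf.path, Tf.tight⟩
  choose mm qq pp Fs hv hq hadj hFs hp htt using hTf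
  let mkTf : (q : Fin k) → IntTermFence m (cz q).1 (cz q).2 (trapScale k₀ (j q)) (rotConfig (f q) (colCfg (κ q) ω)) ↑(cz q).1 :=
    fun q => ⟨mm q, qq q, pp q, Fs q, hv q, hq q, hadj q, hFs q, hp q, htt q⟩
  -- single-arm data
  have hroute := fun q => (𝒯 (κ q)).exit_route hm (hOK q) (hfar q) (by omega) (hEN q)
    (hu q) (hfdef q) (hcz q) (hraw q) (hk2 q) (hkm q) (hz8 q) (mkTf q)
  -- pairs of the same colour
  have pair : ∀ a b, a ≠ b → κ a = κ b →
      Disjoint (triRotIsoPow (f a) '' (frameRd (f a) ((𝒯 (κ a)).final (E a) (x a)) ∪ Fs a ∪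
          triStrip ((cz a).2 0 - 2 * trapScale k₀ (j a)) ((cz a).2 1 + trapScale k₀ (j a)) (trapScale k₀ (j a)) (trapScale k₀ (j a))))
        (triRotIsoPow (f b) '' (frameRd (f b) ((𝒯 (κ b)).final (E b) (x b)) ∪ Fs b ∪
          triStrip ((cz b).2 0 - 2 * trapScale k₀ (j b)) ((cz b).2 1 + trapScale k₀ (j b)) (trapScale k₀ (j b)) (trapScale k₀ (j b)))) ∧
      (f a = f b → (cz a).2 1 ≠ (cz b).2 1) ∧
      (f a = f b → (cz a).2 1 < (cz b).2 1 → (cz a).2 1 + 17 * trapScale k₀ (j a) < (cz b).2 1) := by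
    intro a b hab hκ
    have hbox : f a ≠ f b → ∃ κ₀ : ℕ, trapScale k₀ (j a) ≤ κ₀ ∧ trapScale k₀ (j b) ≤ κ₀ ∧
        (-(m : ℤ) + 8 * κ₀ ≤ (cz a).2 1 ∧ (cz a).2 1 ≤ -(8 * (κ₀ : ℤ))) ∧
        (-(m : ℤ) + 8 * κ₀ ≤ (cz b).2 1 ∧ (cz b).2 1 ≤ -(8 * (κ₀ : ℤ))) := fun _ => by
      have hjm : max (j a) (j b) < K := max_lt (hjK a) (hjK b)
      refine ⟨trapScale k₀ (max (j a) (j b)), trapScale_mono _ (le_max_left _ _), trapScale_mono _ (le_max_right _ _), ?_, ?_⟩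
      · have := hmid a _ hjm
        constructor <;> omega
      · have := hmid b _ hjm
        constructor <;> omega
    -- transport the data of `b` to the colour of `a`
    have hOKb : IntFrameTransversals.MemberOK m (colCfg (κ a) ω) (E b) (x b) := by rw [hκ]; exact hOK b
    have hub : (𝒯 (κ a)).termAt (f b) (E b) (x b) = some (u b) := by rw [hκ]; exact hu b
    have hfb : f b = (𝒯 (κ a)).lastFrame (E b) (x b) := by rw [hκ]; exact hfdef b
    have hczb : (intDom m).lowestSeq (rotConfig (f b) (colCfg (κ a) ω)) (u b) = some (cz b) := by
      rw [hκ]; exact hcz b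
    have hrawb : IntRawOK m (cz b).1 (cz b).2 (trapScale k₀ (j b)) (rotConfig (f b) (colCfg (κ a) ω)) := by
      rw [hκ]; exact hraw b
    have hvb : OpenVCrossThrough (triStrip ((cz b).2 0 - 2 * trapScale k₀ (j b)) ((cz b).2 1 + trapScale k₀ (j b))
        (trapScale k₀ (j b)) (trapScale k₀ (j b))) ((cz b).2 1 + trapScale k₀ (j b))
        ((cz b).2 1 + 2 * trapScale k₀ (j b)) (rotConfig (f b) (colCfg (κ a) ω)) (mm b) := by
      rw [hκ]; exact hv b
    have hFsb : Fs b ⊆ intFenceSet m (cz b).1 (cz b).2 (trapScale k₀ (j b)) (rotConfig (f b) (colCfg (κ a) ω)) ↑(cz b).1 := by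
      rw [hκ]; exact hFs b
    have key := (𝒯 (κ a)).same_colour_pair hm (hOK a) hOKb (hfar a) (hfar b) (hEdisj a b hab) (hu a) (hfdef a) (hcz a)
      (hraw a) (hk1 a) (hkm a) (hz8 a) (mkTf a) hub hfb hczb hrawb (hk1 b) (hkm b) (hz8 b)
      ⟨mm b, qq b, pp b, Fs b, hvb, hq b, hadj b, hFsb, hp b, htt b⟩ (hf6 a) (hf6 b) hbox
    refine ⟨?_, key.2.1, key.2.2⟩
    have e : (𝒯 (κ b)).final (E b) (x b) = (𝒯 (κ a)).final (E b) (x b) := by rw [hκ]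
    rw [e]
    exact key.1
  -- pairs of different colours on a common side
  have cross : ∀ a b, κ a ≠ κ b → f a = f b →
      (cz a).2 1 ≠ (cz b).2 1 ∧ ((cz a).2 1 < (cz b).2 1 → (cz a).2 1 + 8 * trapScale k₀ (j a) < (cz b).2 1) := by
    intro a b hκ hff
    have hcb : colCfg (κ b) ω = (colCfg (κ a) ω)ᶜ := by
      rw [← colCfg_not]
      have hb : ∀ c d : Bool, c ≠ d → d = !c := by decide
      rw [hb _ _ hκ]
    have hsub : (↑(cz b).1 : Set (Site 2)) ⊆ (rotConfig (f a) (colCfg (κ a) ω))ᶜ := by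
      rw [← rotConfig_compl', ← hcb, hff]
      exact (hcr b).2
    exact int_tip_row_gap_of_compl (hcr a).1 (hcr a).2 (hraw a) (hk1 a) (by have := hkm a; omega) (hcr b).1 hsub
  refine ⟨f, fun q => ⟨(cz q).2, j q, mm q, (triRotIsoPow (f q)).symm (x q), tip_isIntJ (hcr q).1, hjK q,
      (by rw [triNorm_rot_symm]; exact hfar q), hv q, (hroute q).1.mono (hroute q).2.1⟩,
    fun q => frameRd (f q) ((𝒯 (κ q)).final (E q) (x q)) ∪ Fs q,
    hf6, fun q => rfl, hmid, fun q => ?_, fun q => (hroute q).1, fun q => (hroute q).2.1, fun q => (hroute q).2.2.1,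
    fun q => (hroute q).2.2.2, fun a b hab hκ => (pair a b hab hκ).1, fun a b hab hi => ?_,
    fun a b hκ hi hlt => (pair a b ?_ hκ).2.2 hi hlt, fun a b hκ hi hlt => (cross a b hκ hi).2 hlt⟩
  · -- protection
    exact ⟨(cz q).1, (cz q).2, rfl, tip_isIntJ (hcr q).1, (hcr q).2, fun _ => ⟨(hcr q).1, hraw q⟩, fun h => absurd h (by decide)⟩
  · -- same side: distinct tips
    by_cases hκ : κ a = κ b
    · exact (pair a b hab hκ).2.1 hi
    · exact (cross a b hκ hi).1
  · rintro rfl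
    exact lt_irrefl _ hlt

end Literature.Probability.Percolation
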